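import Summits.CriticalPhenomena.CardyFormulaZ2.Theorems.CardyIKTransportIKMixedBoxCrossingXorDefs
import Summits.CriticalPhenomena.CardyFormulaZ2.Theorems.CardyIKTransportIKMixedBoxCrossingStubDuality
import Summits.CriticalPhenomena.CardyFormulaZ2.Theorems.CardyIKTransportIKMixedBoxCrossingStubPolyDoubling

/-!
# Stub `stub_condDichotomy` (line `xor-rectangle-flip`, crux `IKMixedBoxCrossing`, stmt-CriticalPhenomena-5911)

Support file (`--supports stmt-CriticalPhenomena-5911`): the CONDITIONAL BOX DICHOTOMY of the line,
`XorFlip → CondBoxDichotomy` (registered signature). For every column pattern `S`, every box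
`[a, a+W) × [b, b+H)` with `W, H ≥ 1` and every event `F` of the EXTERIOR σ-algebra of the box,

  `μ F ≤ μ(bLR ∩ F) + 16/9 · μ(bTB ∩ F)` and `μ F ≤ μ(bTB ∩ F) + 16/9 · μ(bLR ∩ F)`.

Proof.
* POINTWISE DUALITY (`mem_bLR_or_mem_wTB`, `mem_bTB_or_mem_wLR`): every configuration has a black
  left–right crossing of the box or a WHITE bottom–top crossing of it (and symmetrically). For boxes of
  width and height `≥ 2` this is the landed Hex lemma of the one-diagonal-per-face triangulation,
  `DualityStub.xor_lrCross_tbCross`, read through the definitional dictionary "bond field of the crux =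
  `blackEdges` of the observables" (`cellEdges B D = blackEdges (B, D)`); boxes of width or height `1`
  are crossed trivially (the two sides of the bond-reading crossing event meet).
* THE FLIP TURNS WHITE INTO BLACK INSIDE THE BOX (`mem_wTB_iff`, `mem_wLR_iff`): an XOR flip `Φ` of the box
  `Q` replaces the black set `B` by `B ∆ Q`, which agrees with `Bᶜ` on `Q`, and keeps the diagonals; a
  crossing of `Q` only reads edges with both ends in `Q` (`PolyDoublingStub.mem_openCrossing_congr`).
* EXTERIOR EVENTS ARE FLIP-INVARIANT (`flip_mem_iff`): the generators of `exteriorSigma S Q` (colour of a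
  cell off `Q`, diagonal of a face off `Q`) are `Φ`-invariant, hence so is every generated event
  (`MeasurableSpace.forall_generateFrom_mem_iff_mem_iff`).
* ASSEMBLY: `F ⊆ (bLR ∩ F) ∪ Φ ⁻¹' (bTB ∩ F)`, subadditivity of (outer) measure and the density bound
  `μ (Φ ⁻¹' E) ≤ 16/9 · μ E` of `IsRectFlip`. No measurability of crossing events is used.
-/

open scoped ENNReal symmDiff
open MeasureTheory
open Literature.Probability.Percolation Literature.Probability.LatticeModels
open Summit.CriticalPhenomena.CardyFormulaZ2.Theorems.IKMixedBoxCrossing.Negative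
  (Ω μIK blackSet antiSet edges)
open Summit.CriticalPhenomena.CardyFormulaZ2.Theorems.IKLinearTransport.PinnedDiagramExchange
  renaming lrCross → obsLR, tbCross → obsTB
open Summit.CriticalPhenomena.CardyFormulaZ2.Cruxes.IKMixedBoxCrossing.PairedMirrorExploration.DualityStub
  (xor_lrCross_tbCross)
open Summit.CriticalPhenomena.CardyFormulaZ2.Cruxes.IKMixedBoxCrossing.PairedMirrorExploration.PolyDoublingStub
  (mem_openCrossing_congr mk_mem_blackEdges_congr)

noncomputable section

namespace Summit.CriticalPhenomena.CardyFormulaZ2.Cruxes.IKMixedBoxCrossing.XorRectangleFlip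

namespace DichotomyStub

/-! ## §1 The dictionary: the crux's bond field is `blackEdges` of the observables

`cellEdges B D` and `blackEdges (B, D)` have the same body, and the boxes and sides of `bLR`/`bTB` at
natural-number sizes are those of the observables' `lrCross`/`tbCross`: all four bridges are `Iff.rfl`. -/

/-- Black LR crossing of the crux = LR box event of the observables `(blackSet, antiSet)` (definitional). -/
theorem mem_bLR_iff (S : Set ℤ) (a b : ℤ) (w h : ℕ) (ω : Ω) :
    ω ∈ bLR S a b w h ↔ (blackSet S ω, antiSet S ω) ∈ obsLR a b w h := Iff.rfl

/-- Black TB crossing of the crux = TB box event of the observables (definitional). -/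
theorem mem_bTB_iff (S : Set ℤ) (a b : ℤ) (w h : ℕ) (ω : Ω) :
    ω ∈ bTB S a b w h ↔ (blackSet S ω, antiSet S ω) ∈ obsTB a b w h := Iff.rfl

/-- White LR crossing of the crux = LR box event of the colour-flipped observables (definitional). -/
theorem mem_wLR_iff (S : Set ℤ) (a b : ℤ) (w h : ℕ) (ω : Ω) :
    ω ∈ wLR S a b w h ↔ ((blackSet S ω)ᶜ, antiSet S ω) ∈ obsLR a b w h := Iff.rfl

/-- White TB crossing of the crux = TB box event of the colour-flipped observables (definitional). -/
theorem mem_wTB_iff (S : Set ℤ) (a b : ℤ) (w h : ℕ) (ω : Ω) :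
    ω ∈ wTB S a b w h ↔ ((blackSet S ω)ᶜ, antiSet S ω) ∈ obsTB a b w h := Iff.rfl

/-! ## §2 Pointwise duality -/

/-- An integer `≥ 2` is `m + 1` for a natural number `m ≥ 1`. -/
theorem exists_eq_succ_of_two_le {W : ℤ} (hW : 1 < W) : ∃ m : ℕ, 1 ≤ m ∧ W = ((m + 1 : ℕ) : ℤ) := by
  obtain ⟨n, rfl⟩ := Int.eq_ofNat_of_zero_le (show (0 : ℤ) ≤ W by omega)
  exact ⟨n - 1, by omega, by push_cast; omega⟩

/-- A box whose two opposite sides meet is crossed by every bond configuration (bond reading: the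
trivial path at a common cell). -/
theorem mem_openCrossing_of_mem {X A B : Set (Site 2)} {v : Site 2} (hX : v ∈ X) (hA : v ∈ A)
    (hB : v ∈ B) (K : BondConfig (Site 2)) : K ∈ openCrossing X A B :=
  ⟨v, hA, v, hB, hX, hX, SimpleGraph.Reachable.refl _⟩

/-- Width `1`: every bond configuration crosses the box `[a, a+1) × [b, b+H)` from left to right. -/
theorem mem_lrCross_one (a b H : ℤ) (hH : 1 ≤ H) (K : BondConfig (Site 2)) : K ∈ lrCross a b 1 H := by
  refine mem_openCrossing_of_mem (v := ![a, b]) ?_ ?_ ?_ K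
  · simp only [box, Set.mem_setOf_eq, Matrix.cons_val_zero, Matrix.cons_val_one]
    omega
  · simp only [leftCol, Set.mem_setOf_eq, Matrix.cons_val_zero, Matrix.cons_val_one, true_and]
    omega
  · simp only [rightCol, Set.mem_setOf_eq, Matrix.cons_val_zero, Matrix.cons_val_one]
    omega

/-- Height `1`: every bond configuration crosses the box `[a, a+W) × [b, b+1)` from bottom to top. -/
theorem mem_tbCross_one (a b W : ℤ) (hW : 1 ≤ W) (K : BondConfig (Site 2)) : K ∈ tbCross a b W 1 := by
  refine mem_openCrossing_of_mem (v := ![a, b]) ?_ ?_ ?_ K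
  · simp only [box, Set.mem_setOf_eq, Matrix.cons_val_zero, Matrix.cons_val_one]
    omega
  · simp only [bottomRow, Set.mem_setOf_eq, Matrix.cons_val_zero, Matrix.cons_val_one, true_and]
    omega
  · simp only [topRow, Set.mem_setOf_eq, Matrix.cons_val_zero, Matrix.cons_val_one]
    omega

/-- POINTWISE DUALITY I: every configuration has a black left–right crossing or a white bottom–top
crossing of the box (Hex lemma `DualityStub.xor_lrCross_tbCross` for `W, H ≥ 2`; trivial crossings for
`W = 1` or `H = 1`). -/
theorem mem_bLR_or_mem_wTB (S : Set ℤ) (a b W H : ℤ) (hW : 1 ≤ W) (hH : 1 ≤ H) (ω : Ω) :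
    ω ∈ bLR S a b W H ∨ ω ∈ wTB S a b W H := by
  rcases eq_or_lt_of_le hW with rfl | hW2
  · exact Or.inl (mem_lrCross_one a b H hH _)
  rcases eq_or_lt_of_le hH with rfl | hH2
  · exact Or.inr (mem_tbCross_one a b W hW _)
  obtain ⟨m, hm, rfl⟩ := exists_eq_succ_of_two_le hW2
  obtain ⟨n, hn, rfl⟩ := exists_eq_succ_of_two_le hH2
  rcases xor_lrCross_tbCross (blackSet S ω, antiSet S ω) a b hm hn with ⟨h1, -⟩ | ⟨h2, -⟩
  · exact Or.inl ((mem_bLR_iff S a b _ _ ω).2 h1)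
  · exact Or.inr ((mem_wTB_iff S a b _ _ ω).2 h2)

/-- POINTWISE DUALITY II: every configuration has a black bottom–top crossing or a white left–right
crossing of the box (the Hex lemma applied to the colour-flipped observables). -/
theorem mem_bTB_or_mem_wLR (S : Set ℤ) (a b W H : ℤ) (hW : 1 ≤ W) (hH : 1 ≤ H) (ω : Ω) :
    ω ∈ bTB S a b W H ∨ ω ∈ wLR S a b W H := by
  rcases eq_or_lt_of_le hH with rfl | hH2
  · exact Or.inl (mem_tbCross_one a b W hW _)
  rcases eq_or_lt_of_le hW with rfl | hW2
  · exact Or.inr (mem_lrCross_one a b H hH _)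
  obtain ⟨m, hm, rfl⟩ := exists_eq_succ_of_two_le hW2
  obtain ⟨n, hn, rfl⟩ := exists_eq_succ_of_two_le hH2
  rcases xor_lrCross_tbCross ((blackSet S ω)ᶜ, antiSet S ω) a b hm hn with ⟨h1, -⟩ | ⟨h2, -⟩
  · exact Or.inr ((mem_wLR_iff S a b _ _ ω).2 h1)
  · have h2' : (blackSet S ω, antiSet S ω) ∈ obsTB a b (m + 1) (n + 1) := by
      simpa only [compl_compl] using h2
    exact Or.inl ((mem_bTB_iff S a b _ _ ω).2 h2')

/-! ## §3 The flip turns white crossings into black crossings inside the box -/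

/-- On the flipped rectangle, `B ∆ Q` is the complement of `B`. -/
theorem mem_compl_iff_mem_symmDiff {B Q : Set (Site 2)} {u : Site 2} (hu : u ∈ Q) :
    u ∈ Bᶜ ↔ u ∈ B ∆ Q := by
  rw [Set.mem_compl_iff, Set.mem_symmDiff]
  exact ⟨fun h => Or.inr ⟨hu, h⟩, fun h => h.elim (fun h' => (h'.2 hu).elim) And.right⟩

/-- Inside `Q`, the white bonds of `B` are the black bonds of `B ∆ Q` (same diagonals). -/
theorem mk_mem_cellEdges_compl_iff {B D Q : Set (Site 2)} {u v : Site 2} (hu : u ∈ Q) (hv : v ∈ Q) :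
    s(u, v) ∈ cellEdges Bᶜ D ↔ s(u, v) ∈ cellEdges (B ∆ Q) D :=
  mk_mem_blackEdges_congr (x := (Bᶜ, D)) (y := (B ∆ Q, D)) (mem_compl_iff_mem_symmDiff hu)
    (mem_compl_iff_mem_symmDiff hv) (fun _ => Iff.rfl) (fun _ => Iff.rfl) (fun _ => Iff.rfl)
    (fun _ => Iff.rfl)

variable {S : Set ℤ} {a b W H : ℤ} {Φ : Ω → Ω}

/-- An XOR flip of the box carries the white bottom–top crossing onto the black one. -/
theorem mem_wTB_iff_flip_mem_bTB (hΦ : IsRectFlip S (box a b W H) Φ) (ω : Ω) :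
    ω ∈ wTB S a b W H ↔ Φ ω ∈ bTB S a b W H := by
  show whiteEdges S ω ∈ tbCross a b W H ↔ edges S (Φ ω) ∈ tbCross a b W H
  rw [edges_eq_cellEdges, hΦ.black_eq, hΦ.anti_eq]
  exact mem_openCrossing_congr fun u hu v hv => mk_mem_cellEdges_compl_iff hu hv

/-- An XOR flip of the box carries the white left–right crossing onto the black one. -/
theorem mem_wLR_iff_flip_mem_bLR (hΦ : IsRectFlip S (box a b W H) Φ) (ω : Ω) :
    ω ∈ wLR S a b W H ↔ Φ ω ∈ bLR S a b W H := by
  show whiteEdges S ω ∈ lrCross a b W H ↔ edges S (Φ ω) ∈ lrCross a b W H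
  rw [edges_eq_cellEdges, hΦ.black_eq, hΦ.anti_eq]
  exact mem_openCrossing_congr fun u hu v hv => mk_mem_cellEdges_compl_iff hu hv

/-! ## §4 Exterior events are flip-invariant -/

/-- Every event of the exterior σ-algebra of `Q` is invariant under every XOR flip of `Q`: the
generators (colour of a cell off `Q`, diagonal of a face off `Q`) are, and invariance passes to the
generated σ-algebra. -/
theorem flip_mem_iff {Q : Set (Site 2)} (hΦ : IsRectFlip S Q Φ) {F : Set Ω}
    (hF : MeasurableSet[exteriorSigma S Q] F) (ω : Ω) : Φ ω ∈ F ↔ ω ∈ F := by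
  refine MeasurableSpace.forall_generateFrom_mem_iff_mem_iff.2 (fun s hs => ?_) F hF
  rcases hs with ⟨v, hv, rfl⟩ | ⟨f, hf, rfl⟩
  · show v ∈ blackSet S (Φ ω) ↔ v ∈ blackSet S ω
    rw [hΦ.black_eq, Set.mem_symmDiff]
    exact ⟨fun h => h.elim And.left fun h' => (hv h'.1).elim, fun h => Or.inl ⟨h, hv⟩⟩
  · show f ∈ antiSet S (Φ ω) ↔ f ∈ antiSet S ω
    rw [hΦ.anti_eq]

/-! ## §5 Assembly -/

/-- The dichotomy for one box, one flip and one flip-invariant event. -/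
theorem dichotomy_of_flip (hW : 1 ≤ W) (hH : 1 ≤ H) (hΦ : IsRectFlip S (box a b W H) Φ) {F : Set Ω}
    (hinv : ∀ ω, Φ ω ∈ F ↔ ω ∈ F) :
    μIK F ≤ μIK (bLR S a b W H ∩ F) + (16 / 9 : ℝ≥0∞) * μIK (bTB S a b W H ∩ F) ∧
      μIK F ≤ μIK (bTB S a b W H ∩ F) + (16 / 9 : ℝ≥0∞) * μIK (bLR S a b W H ∩ F) := by
  constructor
  · have hsub : F ⊆ (bLR S a b W H ∩ F) ∪ Φ ⁻¹' (bTB S a b W H ∩ F) := fun ω hω => by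
      rcases mem_bLR_or_mem_wTB S a b W H hW hH ω with h | h
      · exact Or.inl ⟨h, hω⟩
      · exact Or.inr ⟨(mem_wTB_iff_flip_mem_bTB hΦ ω).1 h, (hinv ω).2 hω⟩
    calc μIK F ≤ μIK ((bLR S a b W H ∩ F) ∪ Φ ⁻¹' (bTB S a b W H ∩ F)) := measure_mono hsub
      _ ≤ μIK (bLR S a b W H ∩ F) + μIK (Φ ⁻¹' (bTB S a b W H ∩ F)) := measure_union_le _ _
      _ ≤ μIK (bLR S a b W H ∩ F) + (16 / 9 : ℝ≥0∞) * μIK (bTB S a b W H ∩ F) :=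
        add_le_add le_rfl (hΦ.density_le _)
  · have hsub : F ⊆ (bTB S a b W H ∩ F) ∪ Φ ⁻¹' (bLR S a b W H ∩ F) := fun ω hω => by
      rcases mem_bTB_or_mem_wLR S a b W H hW hH ω with h | h
      · exact Or.inl ⟨h, hω⟩
      · exact Or.inr ⟨(mem_wLR_iff_flip_mem_bLR hΦ ω).1 h, (hinv ω).2 hω⟩
    calc μIK F ≤ μIK ((bTB S a b W H ∩ F) ∪ Φ ⁻¹' (bLR S a b W H ∩ F)) := measure_mono hsub
      _ ≤ μIK (bTB S a b W H ∩ F) + μIK (Φ ⁻¹' (bLR S a b W H ∩ F)) := measure_union_le _ _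
      _ ≤ μIK (bTB S a b W H ∩ F) + (16 / 9 : ℝ≥0∞) * μIK (bLR S a b W H ∩ F) :=
        add_le_add le_rfl (hΦ.density_le _)

end DichotomyStub

open DichotomyStub in
/-- **STUB `stub_condDichotomy`** (registered signature, line `xor-rectangle-flip`): the XOR rectangle
flip gives the CONDITIONAL BOX DICHOTOMY — for every column pattern `S`, every box with `W, H ≥ 1` and
every exterior-measurable event `F`, `μ F ≤ μ(bLR ∩ F) + 16/9 · μ(bTB ∩ F)` and
`μ F ≤ μ(bTB ∩ F) + 16/9 · μ(bLR ∩ F)`. -/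
theorem stub_condDichotomy : XorFlip → CondBoxDichotomy := by
  intro hflip S a b W H hW hH F hF
  obtain ⟨Φ, hΦ⟩ := hflip S (box a b W H) ⟨a, b, W, H, rfl⟩
  exact dichotomy_of_flip hW hH hΦ (flip_mem_iff hΦ hF)

end Summit.CriticalPhenomena.CardyFormulaZ2.Cruxes.IKMixedBoxCrossing.XorRectangleFlip

end
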